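import Literature.Barriers.CriticalPhenomena.SubexponentialGrowthZd
import Literature.Barriers.CriticalPhenomena.AmenableInvariantPercolation
import Literature.Probability.Percolation.HalfSpace
import Literature.Probability.Percolation.CoveringTameFibres
import Literature.Geometry.MetricEmbeddings.HeisenbergDisplacementCount
import Mathlib.Algebra.Order.Group.Action.End
import Mathlib.Algebra.Group.Action.Pretransitive
import HarnessLib
import HarnessLib.Audit

/-!
# Transplant targets IV — Conjecture 4 on graphs of POLYNOMIAL growth (lane class C2), its open residue (C3), and the first
# non-Euclidean instance: the Cayley graph of the discrete Heisenberg group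

builds on p205010 (kernel theorem, internal audit signed; external expert review pending).
Status sentence (coordinator 2026-08-20T04:30Z): "θ(p_c) = 0 on ℤ^d, all d ≥ 2 — kernel-verified (Lean 4/Mathlib,
standard axioms); internal adversarial audit SIGNED 2026-08-20 04:29Z; external expert review pending."

STATEMENTS ONLY (lane `prim-bschramm-*`, seat `prim-bschramm-stmt`).  Vocabulary, all TREE: `ballVolume G x n = |B(x,n)|` (graph-distance balls,
`Literature/Barriers/CriticalPhenomena/SubexponentialGrowthZd.lean:138`), `HasExponentialGrowth` (:150), `IsQuasiTransitive` (:156),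
`IsGraphAmenable` (edge-isoperimetric, `AmenableInvariantPercolation.lean:1292`), `criticalProbIOf` (`HalfSpace.lean:91`), and the discrete
Heisenberg group `ℍ(ℤ)` in its upper-triangular model on `ℤ × ℤ × ℤ`, `(x,y,z)·(x',y',z') = (x+x', y+y', z+z'+xy')` (`heisMul`) with the Cayley
graph `Literature.Geometry.MetricEmbeddings.cayleyGraph` of the right generators `a = (1,0,0)`, `b = (0,1,0)`
(`Literature/Geometry/MetricEmbeddings/HeisenbergL1.lean:100-125`; connected: `cayleyGraph_connected`, word balls `|𝔅_r| ≤ (2r+1)²(2r²+1)`: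
`ncard_wordBall_le`, `HeisenbergL1Proofs.lean:157, :553`; inverse `heisInv` and the group identities `heisMul_assoc`, `heisInv_heisMul`,
`heisMul_heisInv_cancel_left`: `HeisenbergLatticeBump.lean:53`, `HeisenbergDisplacementCount.lean:45-250`).  Nothing is re-defined.

Targets (`@[conjecture]` `Prop`s, never asserted):
* `BenjaminiSchramm1996_conj4_polynomialGrowth` — Conjecture 4 restricted to quasi-transitive graphs of polynomial growth
  (`∃ C D, ∀ x n, |B(x,n)| ≤ C (n+1)^D`); by Gromov–Trofimov these are quasi-isometric to Cayley graphs of virtually nilpotent groups.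
  OPEN in print beyond the Euclidean cases ("all of these proofs … completely break down without [exponential growth]", Hermon–Hutchcroft
  2021 §1); the Euclidean case nearest-neighbour `ℤ^d` is p205010 (status sentence above).
* `BenjaminiSchramm1996_conj4_amenableSubexponential` — the OPEN RESIDUE of Conjecture 4 in print and in tree: amenable quasi-transitive graphs
  WITHOUT exponential growth (exponential growth: `Hutchcroft2016_noPercolationAtCriticality_holds`; nonamenable ⊆ exponential growth).
* `HeisenbergCriticalContinuity` — `θ(p_c) = 0` for bond percolation on the Heisenberg Cayley graph (lane class C2, first instance; OPEN).

Proved here (structure of the instance, from tree lemmas): left multiplications are graph automorphisms (`heisLeftIso`), so `Aut` acts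
transitively (`isPretransitive_aut_heisenberg`, Mathlib class) and the graph is quasi-transitive; it is locally finite (instance), connected,
of polynomial growth of degree `4` (`heisenberg_polynomialGrowth`: `|B(x,n)| ≤ (2n+1)^4`) and NOT of exponential growth
(`heisenberg_not_hasExponentialGrowth`) — so it lies in the scope of both conjectures above and outside Hutchcroft 2016.
NOT in the tree (recorded in `run/shared/lean/prim/bschramm/STATEMENTS.md`): `p_c(ℍ(ℤ)) < 1` (available route: the tree's
`GKZ.criticalProb_lt_one_of_latticeMap`, `SupercriticalClusterTransienceSlabs.lean`, with the `ℤ²`-subgroup `⟨a, c⟩`), amenability of `ℍ(ℤ)`.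
Distance from the p205010 chain (postcont-2 `USES.md` §4 row R1): blocks (B)(C) verbatim; block (D) has no written analogue (no commuting rank-2
translation lattice with product boxes and reflections) — new ideas needed.
-/

noncomputable section

namespace Summit.CriticalPhenomena.PercolationContinuityZ3.Theorems.Transplant

open MeasureTheory Filter Literature.Probability.Percolation Literature.Probability.LatticeModels
open Literature.Barriers.CriticalPhenomena (IsQuasiTransitive IsGraphTransitive IsGraphAmenable HasExponentialGrowth graphBall ballVolume
  eventually_pow_lt_const_pow)
open Literature.Geometry.MetricEmbeddings (heisMul heisInv cayleyGraph cayleyGraph_adj cayleyGraph_adj_heisMul_left heisMul_inv_left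
  heisMul_assoc heisMul_zero_right heisInv_heisMul heisMul_heisInv_cancel_left cayleyGraph_connected wordBall ncard_wordBall_le)

/-! ## TARGET 4-C2 — polynomial growth -/

/-- **Conjecture 4 for quasi-transitive graphs of POLYNOMIAL GROWTH (OPEN — a `Prop`, never asserted):** for every connected, locally finite,
quasi-transitive graph with `|B(x,n)| ≤ C (n+1)^D` uniformly, and every `x` with `p_c(G) < 1`: `θ_x(p_c(G)) = 0`.  The lane's class C2
(Cayley graphs of virtually nilpotent groups; other 3D lattices; `ℤ^d × F`).  Printed status: open beyond nearest-neighbour `ℤ^d` (p205010,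
status sentence in the module docstring), `ℤ²`-based slabs (DCST 2016) and `d ≥ 11` (lace expansion).
[cite: BenjaminiSchramm1996, Conj. 4] [cite: HermonHutchcroft2021, §1] [cite: ContrerasMartineauTassion2024, §1] -/
@[conjecture] def BenjaminiSchramm1996_conj4_polynomialGrowth : Prop :=
  ∀ {V : Type} (G : SimpleGraph V) [G.LocallyFinite], G.Connected → IsQuasiTransitive G →
    (∃ C D : ℝ, ∀ (x : V) (n : ℕ), (ballVolume G x n : ℝ) ≤ C * ((n : ℝ) + 1) ^ D) →
      ∀ x : V, criticalProb G x < 1 → theta G x (criticalProbIOf G x) = 0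

/-! ## TARGET 4-C3 — the open residue: amenable, subexponential growth -/

/-- **Conjecture 4 on AMENABLE quasi-transitive graphs WITHOUT exponential growth (OPEN — a `Prop`, never asserted)** — the residue of
Conjecture 4 not covered by a printed theorem (exponential growth: Hutchcroft 2016, in tree; nonamenable unimodular: BLPS 1999, in tree;
nonamenable ⟹ exponential growth): polynomial growth (class C2) together with intermediate growth below the Hermon–Hutchcroft heat-kernel
threshold.  `IsGraphAmenable` needs `DecidableEq V`. [cite: BenjaminiSchramm1996, Conj. 4] [cite: HermonHutchcroft2021, §1 and Thm. 1.2]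
[cite: Hutchcroft2016, Thm. 1] -/
@[conjecture] def BenjaminiSchramm1996_conj4_amenableSubexponential : Prop :=
  ∀ {V : Type} [DecidableEq V] (G : SimpleGraph V) [G.LocallyFinite], G.Connected → IsQuasiTransitive G →
    IsGraphAmenable G → ¬ HasExponentialGrowth G →
      ∀ x : V, criticalProb G x < 1 → theta G x (criticalProbIOf G x) = 0

/-! ## TARGET 4-C2(H) — the discrete Heisenberg group -/

/-- **`θ(p_c) = 0` for bond percolation on the Cayley graph of the discrete Heisenberg group `ℍ(ℤ)` (generators `a, b`), rooted at the
identity (OPEN — a `Prop`, never asserted).**  Polynomial growth of degree 4, non-Euclidean: not covered by Hutchcroft 2016 / Hermon–Hutchcroft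
2021, nor by p205010's `ℤ^d` renormalisation.  The lane's first class-C2 instance. [cite: BenjaminiSchramm1996, Conj. 4]
[cite: HermonHutchcroft2021, §1] -/
@[conjecture] def HeisenbergCriticalContinuity : Prop :=
  theta cayleyGraph ((0, 0, 0) : ℤ × ℤ × ℤ) (criticalProbIOf cayleyGraph ((0, 0, 0) : ℤ × ℤ × ℤ)) = 0

/-! ## The Heisenberg Cayley graph lies in the scope of both conjectures (proved from tree lemmas) -/

/-- `k⁻¹ · (k · g) = g` (tree `heisMul_inv_left`, spelled with the tree's `heisInv`). [cite: CheegerKleinerNaor2011, §1.1] -/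
theorem heisMul_heisInv_cancel_left' (k g : ℤ × ℤ × ℤ) : heisMul (heisInv k) (heisMul k g) = g :=
  heisMul_inv_left k g

/-- **Left multiplication `g ↦ k·g` is a graph automorphism of the Cayley graph** (edges are RIGHT multiplications by generators; tree:
`cayleyGraph_adj_heisMul_left`). [cite: CheegerKleinerNaor2011, §1.1 ("left invariant")] -/
def heisLeftIso (k : ℤ × ℤ × ℤ) : cayleyGraph ≃g cayleyGraph where
  toFun := heisMul k
  invFun := heisMul (heisInv k)
  left_inv := heisMul_heisInv_cancel_left' k
  right_inv := heisMul_heisInv_cancel_left k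
  map_rel_iff' := by
    intro g h
    refine ⟨fun hgh => ?_, cayleyGraph_adj_heisMul_left k⟩
    have := cayleyGraph_adj_heisMul_left (heisInv k) hgh
    simp only [Equiv.coe_fn_mk, heisMul_heisInv_cancel_left'] at this
    exact this

/-- `heisLeftIso k` acts by `g ↦ k·g`. [folklore] -/
@[simp] theorem heisLeftIso_apply (k g : ℤ × ℤ × ℤ) : heisLeftIso k g = heisMul k g := rfl

/-- **`Aut` acts transitively on the Heisenberg Cayley graph** (Mathlib class): `h·g⁻¹` maps `g` to `h`. [cite: BenjaminiSchramm1996, §2 (Cayley graphs are transitive)] -/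
theorem isPretransitive_aut_heisenberg : MulAction.IsPretransitive (cayleyGraph ≃g cayleyGraph) (ℤ × ℤ × ℤ) :=
  ⟨fun g h => ⟨heisLeftIso (heisMul h (heisInv g)), by
    rw [RelIso.smul_def]
    change heisMul (heisMul h (heisInv g)) g = h
    rw [heisMul_assoc, heisInv_heisMul, heisMul_zero_right]⟩⟩

/-- The Heisenberg Cayley graph is transitive in the tree's sense. [cite: BenjaminiSchramm1996, §2] -/
theorem isGraphTransitive_heisenberg : IsGraphTransitive cayleyGraph :=
  fun x y => isPretransitive_aut_heisenberg.exists_smul_eq x y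

/-- … hence quasi-transitive ("almost transitive", `V₀ = {1}`). [cite: BenjaminiSchramm1996, §2] -/
theorem isQuasiTransitive_heisenberg : IsQuasiTransitive cayleyGraph :=
  ⟨{(0, 0, 0)}, fun v => by
    obtain ⟨γ, hγ⟩ := isGraphTransitive_heisenberg v (0, 0, 0)
    exact ⟨γ, by rw [hγ]; exact Finset.mem_singleton_self _⟩⟩

/-- The neighbours of `g` lie among the four points `g·a^{±1}`, `g·b^{±1}`. [cite: CheegerKleinerNaor2011, §1.1] -/
theorem heisenberg_neighborSet_subset (g : ℤ × ℤ × ℤ) :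
    cayleyGraph.neighborSet g ⊆
      {(g.1 + 1, g.2.1, g.2.2), (g.1, g.2.1 + 1, g.2.2 + g.1), (g.1 - 1, g.2.1, g.2.2), (g.1, g.2.1 - 1, g.2.2 - g.1)} := by
  intro h hh
  rw [SimpleGraph.mem_neighborSet, cayleyGraph_adj] at hh
  obtain ⟨-, (h1 | h2) | (h3 | h4)⟩ := hh
  · exact Or.inl h1
  · exact Or.inr (Or.inl h2)
  · right; right; left
    obtain ⟨x, y, z⟩ := h
    simp only [Prod.mk.injEq] at h3 ⊢
    obtain ⟨e1, e2, e3⟩ := h3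
    exact ⟨by linarith, by linarith, by linarith⟩
  · right; right; right
    obtain ⟨x, y, z⟩ := h
    simp only [Prod.mk.injEq, Set.mem_singleton_iff] at h4 ⊢
    obtain ⟨e1, e2, e3⟩ := h4
    exact ⟨by linarith, by linarith, by linarith⟩

/-- The Heisenberg Cayley graph is locally finite (degree `≤ 4`). [cite: BenjaminiSchramm1996, §2 ("locally finite")] -/
instance heisenberg_locallyFinite : cayleyGraph.LocallyFinite := fun g =>
  ((Set.toFinite _).subset (heisenberg_neighborSet_subset g)).fintype

/-- The ball of the Cayley graph about the identity is the tree's word ball (same set, by `rfl`). [folklore] -/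
theorem graphBall_heisenberg_zero (n : ℕ) : graphBall cayleyGraph ((0, 0, 0) : ℤ × ℤ × ℤ) n = wordBall n := rfl

/-- **Polynomial growth of degree 4, uniformly in the centre**: `|B(x,n)| ≤ (2n+1)^4` (tree: `|𝔅_n| ≤ (2n+1)²(2n²+1)`, `ncard_wordBall_le`,
moved to `x` by the automorphism `heisLeftIso x` and `ballVolume_map_eq`). [cite: CheegerKleinerNaor2011, §1.1] -/
theorem ballVolume_heisenberg_le (x : ℤ × ℤ × ℤ) (n : ℕ) : ballVolume cayleyGraph x n ≤ (2 * n + 1) ^ 4 := by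
  have hx : x = heisLeftIso x (0, 0, 0) := by rw [heisLeftIso_apply, heisMul_zero_right]
  rw [hx, ballVolume_map_eq, ballVolume, graphBall_heisenberg_zero]
  have hsq : 2 * n ^ 2 + 1 ≤ (2 * n + 1) ^ 2 := by
    have h : (2 * n + 1) ^ 2 = (2 * n ^ 2 + 1) + (2 * n ^ 2 + 4 * n) := by ring
    rw [h]; exact Nat.le_add_right _ _
  calc (wordBall n).ncard ≤ (2 * n + 1) ^ 2 * (2 * n ^ 2 + 1) := ncard_wordBall_le n
    _ ≤ (2 * n + 1) ^ 2 * (2 * n + 1) ^ 2 := Nat.mul_le_mul_left _ hsq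
    _ = (2 * n + 1) ^ 4 := by ring

/-- The Heisenberg Cayley graph satisfies the uniform polynomial-growth hypothesis of `BenjaminiSchramm1996_conj4_polynomialGrowth`
(`C = 16`, `D = 4` (as a real exponent, `Real.rpow_natCast`): `(2n+1)^4 ≤ 16 (n+1)^4`). [cite: CheegerKleinerNaor2011, §1.1] -/
theorem heisenberg_polynomialGrowth :
    ∃ C D : ℝ, ∀ (x : ℤ × ℤ × ℤ) (n : ℕ), (ballVolume cayleyGraph x n : ℝ) ≤ C * ((n : ℝ) + 1) ^ D := by
  refine ⟨16, ((4 : ℕ) : ℝ), fun x n => ?_⟩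
  rw [Real.rpow_natCast]
  have h1 : (ballVolume cayleyGraph x n : ℝ) ≤ (2 * n + 1) ^ 4 := by exact_mod_cast ballVolume_heisenberg_le x n
  have h2 : ((2 : ℝ) * n + 1) ^ 4 ≤ 16 * ((n : ℝ) + 1) ^ 4 := by
    have : (2 : ℝ) * n + 1 ≤ 2 * ((n : ℝ) + 1) := by linarith
    calc ((2 : ℝ) * n + 1) ^ 4 ≤ (2 * ((n : ℝ) + 1)) ^ 4 := pow_le_pow_left₀ (by positivity) this 4
      _ = 16 * ((n : ℝ) + 1) ^ 4 := by ring
  exact h1.trans h2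

/-- **The Heisenberg Cayley graph does NOT have exponential growth** (`|B(0,n)| ≤ (2n+1)^4 < c^n` eventually for every `c > 1`), so it is
outside the hypothesis class of Hutchcroft 2016 / `Hutchcroft2016_noPercolationAtCriticality`. [cite: Hutchcroft2016, Thm. 1]
[cite: HermonHutchcroft2021, §1] -/
theorem heisenberg_not_hasExponentialGrowth : ¬ HasExponentialGrowth cayleyGraph := by
  intro h
  obtain ⟨c, hc, hev⟩ := h (0, 0, 0)
  obtain ⟨n, hn1, hn2⟩ := (hev.and (eventually_pow_lt_const_pow 4 hc)).exists
  have hvol : (ballVolume cayleyGraph (0, 0, 0) n : ℝ) ≤ (2 * n + 1) ^ 4 := by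
    exact_mod_cast ballVolume_heisenberg_le (0, 0, 0) n
  linarith

/-- **The Heisenberg Cayley graph is in the scope of Conjecture 4 (classes C2/C3) up to `p_c < 1`**: connected (tree `cayleyGraph_connected`),
locally finite, `Aut`-transitive, quasi-transitive, of polynomial growth and not of exponential growth.  (`p_c(ℍ(ℤ)) < 1` is not yet a tree
theorem.) [cite: BenjaminiSchramm1996, Conj. 4 and §2] -/
theorem heisenberg_in_scope :
    cayleyGraph.Connected ∧ MulAction.IsPretransitive (cayleyGraph ≃g cayleyGraph) (ℤ × ℤ × ℤ) ∧ IsQuasiTransitive cayleyGraph ∧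
      (∃ C D : ℝ, ∀ (x : ℤ × ℤ × ℤ) (n : ℕ), (ballVolume cayleyGraph x n : ℝ) ≤ C * ((n : ℝ) + 1) ^ D) ∧
        ¬ HasExponentialGrowth cayleyGraph :=
  ⟨cayleyGraph_connected, isPretransitive_aut_heisenberg, isQuasiTransitive_heisenberg, heisenberg_polynomialGrowth,
    heisenberg_not_hasExponentialGrowth⟩

/-- The C2 conjecture, together with `p_c(ℍ(ℤ)) < 1`, gives the Heisenberg target. [folklore] -/
theorem heisenbergCriticalContinuity_of_conj4_polynomialGrowth (h : BenjaminiSchramm1996_conj4_polynomialGrowth)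
    (hpc : criticalProb cayleyGraph ((0, 0, 0) : ℤ × ℤ × ℤ) < 1) : HeisenbergCriticalContinuity :=
  h cayleyGraph cayleyGraph_connected isQuasiTransitive_heisenberg heisenberg_polynomialGrowth (0, 0, 0) hpc

end Summit.CriticalPhenomena.PercolationContinuityZ3.Theorems.Transplant
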